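import Literature.NumberTheory.LFunctions.KeiperLiTrend
import Literature.Analysis.SpecialFunctions.DigammaReflection
import HarnessLib

/-!
# RH-FREE: the archimedean trend of the Li coefficients of a Dirichlet `L`-function

Topic `Literature/NumberTheory/LFunctions` (sibling and model: `KeiperLiTrend.lean`, the case of `ζ`).
Everything here is PROVED; there are no definitions and no named facts.  **RH-FREE and GRH-FREE**: no zero
and no value of any `L`-function enters — the object is the Li functional of a GAMMA FACTOR.

## The object

For a Dirichlet character `χ mod q` of parity `a ∈ {0, 1}` the completed `L`-function is
`ξ(s, χ) = (q/π)^{(s+a)/2} Γ((s+a)/2) L(s, χ)` and Li's coefficients are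
`λ_χ(n) = (1/(n−1)!) dⁿ/dsⁿ [s^{n−1} log ξ(s, χ)]_{s=1} = n·[zⁿ] log ξ(1/(1−z), χ)` (Li 2004, (2.3)).  Exactly as
for `ζ` (Bombieri–Lagarias 1999, Thm 2; Voros 2006, §4) the Gamma factor `G_χ(s) = ((s+a)/2) log(q/π) +
log Γ((s+a)/2)`, `G_χ′(s) = ½ log(q/π) + ½ ψ((s+a)/2)`, contributes the ARCHIMEDEAN TREND, which after Li's
change of variables `s = L := 1/(1−z)` (`liMap`, `L′ = L²`, `LiCriterion.iteratedDeriv_pow_mul_eq_iteratedDeriv_comp_liMap`)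
is the Taylor coefficient `Re 𝒜_{c,a}^{(n−1)}(0)/(n−1)!` of the generating function

  `𝒜_{c,a}(z) := (c/2 + ½ ψ((L + a)/2))·L²`,  `c = log(q/π)`,  `L = liMap z`

(compare `ζ`: `𝒜 = L + (−½ log π + ½ ψ(L/2)) L²`, `KeiperLiTrend.keiperLiCoeff_sub_osc_eq_iteratedDeriv`; the extra
`L` is the polar factor of `ξ`, absent for `χ ≠ 1`).  Lagarias 2007, (1.13)–(1.15), records the shape
`(n/2) log n + C n + O(1)` of this archimedean term for automorphic `L`-functions.

## Results (uniform in the real parameter `c` and in `n = m + 1 ≥ 1`)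

* `abs_re_liTrendGen_even_sub_le` (`a = 0`):
  `|Re 𝒜_{c,0}^{(m)}(0)/m! − ( ((m+1)/2)(H_{m+1} − 1 − log 2 + c) − 1/2 )| ≤ 2/π`;
* `abs_re_liTrendGen_odd_sub_le` (`a = 1`):
  `|Re 𝒜_{c,1}^{(m)}(0)/m! − ((m+1)/2)(H_{m+1} − 1 − log 2 + c)| ≤ 1/12 + 1/(2π) + 2/π` (`< 0.88`).

With `c = log(q/π)`: `H_n − 1 − log 2 + c = H_n − 1 − log(2π/q)`, i.e. the trend is
`(n/2)(H_n − 1 − log(2π/q)) + (a − 1)/2 + O(1)` for BOTH parities, whence the linear coefficient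
`(γ − 1)/2 − ½ log(2π/q)` of `λ_χ(n) = ½ n log n + c_χ n + …` (Lagarias 2007 (1.13); the certified tables of the
`rh-li` cell, DATA.md §J (S2), show the `O(1)` is in fact `≤ 0.14` and `→ 0`).

## Proofs

EVEN: pointwise `𝒜_{c,0} = 𝒜_ζ − L + ((c + log π)/2) L²`, so the coefficient is the `ζ` trend minus `1` plus
`(m+1)(c + log π)/2`, and `KeiperLiTrend.abs_keiperLiCoeff_sub_osc_sub_trend_le` (error `≤ 2/π`) applies verbatim.
ODD: Legendre's duplication `ψ(L/2) + ψ(L/2 + ½) = 2ψ(L) − 2 log 2`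
(`Literature.Analysis.SpecialFunctions.Complex.digamma_add_digamma_add_half`) on the unit disc gives
`𝒜_{c,1} = κL² + L/2 − 1/12 + L² Log L + Φ − 𝒜_ζ`, `κ = c/2 − log 2 − ½ log π`, `Φ = L²(ψ(L) − Log L + 1/(2L) + 1/(12L²))`;
the Taylor coefficients of `L² Log L` are `(m+1)!(H_{m+1} − 1)` (`L² Log L = ((Log L − 1)L)′`), and the second-order
Stirling remainder (`KeiperLiTrend.norm_digamma_sub_stirling_two_le`) gives `|Φ| ≤ 1/(4π Re L) < 1/(2π)` on the disc
(`Re L > ½`), so Cauchy's estimate bounds `|Φ^{(m)}(0)| ≤ m!/(2π)`.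

## References

* X.-J. Li, *Explicit formulas for Dirichlet and Hecke L-functions*, Illinois J. Math. 48 (2004) 491–503, (2.3). [Li2004]
* J. C. Lagarias, *Li coefficients for automorphic L-functions*, Ann. Inst. Fourier 57 (2007) 1689–1740,
  (1.13)–(1.15). [Lagarias2007LiCoefficients]
* A. Voros, *Sharpenings of Li's criterion for the Riemann hypothesis*, Math. Phys. Anal. Geom. 9 (2006), §4. [Voros2006]
* E. Bombieri, J. C. Lagarias, J. Number Theory 77 (1999) 274–287, Thm 2. [BombieriLagarias1999]
-/

noncomputable section

open Complex Filter Topology Set Metric Finset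
open scoped Nat

namespace Literature.NumberTheory.LFunctions

/-! ### The Li map on the unit disc (as in `KeiperLiTrend.lean`) -/

/-- For `|z| < 1`, `z ≠ 1`. [folklore] -/
private theorem ne_one_of_norm_lt_one {z : ℂ} (hz : ‖z‖ < 1) : z ≠ 1 := fun h ↦ by simp [h] at hz

/-- For `|z| < 1`, `Re (1/(1−z)) > 1/2`. [folklore] -/
private theorem one_half_lt_re_liMap {z : ℂ} (hz : ‖z‖ < 1) : 1 / 2 < (liMap z).re := by
  have hne : (1 - z) ≠ 0 := sub_ne_zero.2 (Ne.symm (ne_one_of_norm_lt_one hz))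
  have hns : 0 < Complex.normSq (1 - z) := Complex.normSq_pos.2 hne
  rw [liMap, Complex.inv_re, lt_div_iff₀ hns]
  have h1 : Complex.normSq (1 - z) = (1 - z.re) ^ 2 + z.im ^ 2 := by
    rw [Complex.normSq_apply]; simp; ring
  have h2 : z.re ^ 2 + z.im ^ 2 < 1 := by
    have h3 : Complex.normSq z < 1 := by
      rw [Complex.normSq_eq_norm_sq]; nlinarith [norm_nonneg z]
    rw [Complex.normSq_apply] at h3; nlinarith
  rw [h1]
  simp only [sub_re, one_re]
  nlinarith

/-- `m(z) ≠ 0` for `z ≠ 1`. [folklore] -/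
private theorem liMap_ne_zero (z : ℂ) (hz : z ≠ 1) : liMap z ≠ 0 :=
  inv_ne_zero (sub_ne_zero.2 (Ne.symm hz))

/-- On the unit disc `m(z)` lies in the right half-plane. [folklore] -/
private theorem re_liMap_pos {z : ℂ} (hz : ‖z‖ < 1) : 0 < (liMap z).re := by
  linarith [one_half_lt_re_liMap hz]

/-- On the unit disc `m(z)/2` lies in the right half-plane. [folklore] -/
private theorem re_liMap_half_pos {z : ℂ} (hz : ‖z‖ < 1) : 0 < (liMap z / 2).re := by
  have h := one_half_lt_re_liMap hz
  rw [Complex.div_ofNat_re]; linarith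

/-- `dᵐ/dzᵐ [m(z)²](0) = (m+1)!` (`m² = m'`). [folklore] -/
private theorem iteratedDeriv_liMap_sq_zero (m : ℕ) :
    iteratedDeriv m (fun z ↦ liMap z ^ 2) 0 = ((m + 1)! : ℂ) := by
  have hev : (fun z ↦ liMap z ^ 2) =ᶠ[𝓝 (0 : ℂ)] deriv liMap := by
    filter_upwards [eventually_ne_nhds (zero_ne_one : (0 : ℂ) ≠ 1)] with z hz
    exact (hasDerivAt_liMap hz).deriv.symm
  rw [hev.iteratedDeriv_eq, ← iteratedDeriv_succ', iteratedDeriv_liMap_zero]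

/-! ### Taylor coefficients of `L² Log L` -/

/-- On the unit disc, `d/dz Log(m(z)) = m(z)`. [folklore] -/
private theorem hasDerivAt_log_liMap {z : ℂ} (hz : ‖z‖ < 1) :
    HasDerivAt (fun z ↦ Complex.log (liMap z)) (liMap z) z := by
  have hz1 := ne_one_of_norm_lt_one hz
  have hsl : liMap z ∈ slitPlane := Complex.mem_slitPlane_iff.2 (Or.inl (re_liMap_pos hz))
  have h1 : HasDerivAt liMap (liMap z ^ 2) z := hasDerivAt_liMap hz1
  convert h1.clog hsl using 1
  have h0 := liMap_ne_zero z hz1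
  field_simp

/-- `Log(m(·))` is analytic on the unit disc. [folklore] -/
private theorem analyticAt_log_liMap {z : ℂ} (hz : ‖z‖ < 1) :
    AnalyticAt ℂ (fun z ↦ Complex.log (liMap z)) z := by
  have hz1 := ne_one_of_norm_lt_one hz
  exact (analyticAt_liMap hz1).clog (Complex.mem_slitPlane_iff.2 (Or.inl (re_liMap_pos hz)))

/-- `d^{i+1}/dz^{i+1} [Log(m(z))](0) = i!`. [folklore] -/
private theorem iteratedDeriv_succ_log_liMap_zero (i : ℕ) :
    iteratedDeriv (i + 1) (fun z ↦ Complex.log (liMap z)) 0 = (i ! : ℂ) := by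
  rw [iteratedDeriv_succ']
  have hev : deriv (fun z ↦ Complex.log (liMap z)) =ᶠ[𝓝 (0 : ℂ)] liMap := by
    filter_upwards [Metric.ball_mem_nhds (0 : ℂ) one_pos] with z hz
    exact (hasDerivAt_log_liMap (by simpa using hz)).deriv
  rw [hev.iteratedDeriv_eq, iteratedDeriv_liMap_zero]

/-- Leibniz: `d^N/dz^N [(Log(m(z)) − 1) · m(z)](0) = N! (H_N − 1)`, `H_N = Σ_{i<N} 1/(i+1)`. [folklore] -/
private theorem iteratedDeriv_log_liMap_mul_zero (N : ℕ) :
    iteratedDeriv N (fun z ↦ (-1 + Complex.log (liMap z)) * liMap z) 0 =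
      (N ! : ℂ) * ((∑ i ∈ Finset.range N, ((i : ℂ) + 1)⁻¹) - 1) := by
  have hF : ContDiffAt ℂ N (fun z ↦ -1 + Complex.log (liMap z)) 0 :=
    (analyticAt_const.add (analyticAt_log_liMap (by simp))).contDiffAt
  have hL : ContDiffAt ℂ N liMap 0 := (analyticAt_liMap zero_ne_one).contDiffAt
  rw [iteratedDeriv_fun_mul hF hL, Finset.sum_range_succ']
  have h0 : iteratedDeriv 0 (fun z ↦ -1 + Complex.log (liMap z)) 0 = -1 := by
    rw [iteratedDeriv_zero, liMap_zero, Complex.log_one]; ring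
  have hS : ∀ i ∈ Finset.range N, (N.choose (i + 1) : ℂ) *
      iteratedDeriv (i + 1) (fun z ↦ -1 + Complex.log (liMap z)) 0 *
      iteratedDeriv (N - (i + 1)) liMap 0 = (N ! : ℂ) * ((i : ℂ) + 1)⁻¹ := by
    intro i hi
    have hi' : i + 1 ≤ N := Finset.mem_range.1 hi
    rw [iteratedDeriv_const_add (Nat.succ_pos i), iteratedDeriv_liMap_zero,
      iteratedDeriv_succ_log_liMap_zero]
    have hc := congrArg (Nat.cast : ℕ → ℂ) (Nat.choose_mul_factorial_mul_factorial hi')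
    push_cast [Nat.factorial_succ] at hc
    have hi0 : ((i : ℂ) + 1) ≠ 0 := by exact_mod_cast Nat.succ_ne_zero i
    field_simp
    linear_combination hc
  rw [Finset.sum_congr rfl hS, h0, ← Finset.mul_sum, Nat.choose_zero_right, Nat.sub_zero,
    iteratedDeriv_liMap_zero]
  push_cast
  ring

/-- **Taylor coefficients of `m(z)² Log m(z)`**: `dᵐ/dzᵐ [m² Log m](0) = (m+1)! (H_{m+1} − 1)`
(`m² Log m` is the derivative of `(Log m − 1)·m`). [folklore] -/
private theorem iteratedDeriv_liMap_sq_mul_log_zero (m : ℕ) :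
    iteratedDeriv m (fun z ↦ liMap z ^ 2 * Complex.log (liMap z)) 0 =
      ((m + 1)! : ℂ) * ((∑ i ∈ Finset.range (m + 1), ((i : ℂ) + 1)⁻¹) - 1) := by
  have hev : (fun z ↦ liMap z ^ 2 * Complex.log (liMap z)) =ᶠ[𝓝 (0 : ℂ)]
      deriv (fun z ↦ (-1 + Complex.log (liMap z)) * liMap z) := by
    filter_upwards [Metric.ball_mem_nhds (0 : ℂ) one_pos] with z hz
    have hz' : ‖z‖ < 1 := by simpa using hz
    have h1 := hasDerivAt_log_liMap hz'
    have h2 := hasDerivAt_liMap (ne_one_of_norm_lt_one hz')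
    have h3 : HasDerivAt (fun z ↦ (-1 + Complex.log (liMap z)) * liMap z)
        (liMap z * liMap z + (-1 + Complex.log (liMap z)) * liMap z ^ 2) z :=
      (h1.const_add (-1)).mul h2
    have hL0 := liMap_ne_zero z (ne_one_of_norm_lt_one hz')
    rw [h3.deriv]
    ring
  rw [hev.iteratedDeriv_eq, ← iteratedDeriv_succ', iteratedDeriv_log_liMap_mul_zero]

/-- The ELEMENTARY part of the odd generating function, `E(z) = κ L² + L/2 − 1/12 + L² Log L`
(`L = m(z)`): its Taylor coefficients are
`E^{(m)}(0)/m! = κ (m+1) + 1/2 − [m = 0]/12 + (m+1)(H_{m+1} − 1)`. [folklore] -/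
private theorem iteratedDeriv_oddElem_zero (κ : ℂ) (m : ℕ) :
    iteratedDeriv m (fun z ↦ κ * liMap z ^ 2 + liMap z / 2 - 1 / 12 +
        liMap z ^ 2 * Complex.log (liMap z)) 0 =
      (m ! : ℂ) * (κ * ((m : ℂ) + 1) + 1 / 2 - (if m = 0 then 1 / 12 else 0) +
        ((m : ℂ) + 1) * ((∑ i ∈ Finset.range (m + 1), ((i : ℂ) + 1)⁻¹) - 1)) := by
  have hA : AnalyticAt ℂ liMap 0 := analyticAt_liMap zero_ne_one
  have h1 : ContDiffAt ℂ m (fun z ↦ κ * liMap z ^ 2) 0 := (analyticAt_const.mul (hA.pow 2)).contDiffAt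
  have h2 : ContDiffAt ℂ m (fun z ↦ liMap z / 2) 0 := (hA.div analyticAt_const two_ne_zero).contDiffAt
  have h3 : ContDiffAt ℂ m (fun _ : ℂ ↦ (1 / 12 : ℂ)) 0 := contDiffAt_const
  have h4 : ContDiffAt ℂ m (fun z ↦ liMap z ^ 2 * Complex.log (liMap z)) 0 :=
    ((hA.pow 2).mul (analyticAt_log_liMap (by simp))).contDiffAt
  rw [iteratedDeriv_fun_add ((h1.add h2).sub h3) h4, iteratedDeriv_fun_sub (h1.add h2) h3,
    iteratedDeriv_fun_add h1 h2, iteratedDeriv_const_mul_field, iteratedDeriv_liMap_sq_zero,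
    iteratedDeriv_div_const, iteratedDeriv_liMap_zero, iteratedDeriv_const,
    iteratedDeriv_liMap_sq_mul_log_zero]
  split_ifs with hm
  · subst hm; push_cast; ring
  · push_cast [Nat.factorial_succ]; ring

/-! ### The Stirling remainder part and Cauchy's estimate -/

/-- The remainder `Φ(z) = L²(ψ(L) − Log L + 1/(2L) + 1/(12L²))` (`L = m(z)`) is bounded by `1/(2π)` on the
unit disc (second-order Stirling: `‖…‖ ≤ 1/(4π‖L‖² Re L)` and `Re L > 1/2`). [folklore] -/
private theorem norm_oddRem_le {z : ℂ} (hz : ‖z‖ < 1) :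
    ‖liMap z ^ 2 * (Complex.digamma (liMap z) - Complex.log (liMap z) + 1 / (2 * liMap z) +
        1 / (12 * liMap z ^ 2))‖ ≤ 1 / (2 * Real.pi) := by
  have hre : 0 < (liMap z).re := re_liMap_pos hz
  have hhalf := one_half_lt_re_liMap hz
  have h := norm_digamma_sub_stirling_two_le hre
  have hL0 : liMap z ≠ 0 := liMap_ne_zero z (ne_one_of_norm_lt_one hz)
  have hLn : 0 < ‖liMap z‖ := norm_pos_iff.2 hL0
  rw [norm_mul, norm_pow]
  calc ‖liMap z‖ ^ 2 * ‖Complex.digamma (liMap z) - Complex.log (liMap z) + 1 / (2 * liMap z) +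
        1 / (12 * liMap z ^ 2)‖
      ≤ ‖liMap z‖ ^ 2 * (1 / (4 * Real.pi) / (‖liMap z‖ ^ 2 * (liMap z).re)) := by gcongr
    _ = 1 / (4 * Real.pi) / (liMap z).re := by
        have hπ : Real.pi ≠ 0 := Real.pi_ne_zero
        field_simp
    _ ≤ 1 / (2 * Real.pi) := by
        rw [div_le_div_iff₀ (by positivity) (by positivity)]
        have hπ : Real.pi ≠ 0 := Real.pi_ne_zero
        have : 1 / (4 * Real.pi) * (2 * Real.pi) = 1 / 2 := by field_simp; ring
        rw [this]
        linarith

/-- The remainder `Φ` is holomorphic on the unit disc. [folklore] -/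
private theorem differentiableOn_oddRem :
    DifferentiableOn ℂ (fun z ↦ liMap z ^ 2 * (Complex.digamma (liMap z) - Complex.log (liMap z) +
      1 / (2 * liMap z) + 1 / (12 * liMap z ^ 2))) (ball 0 1) := by
  intro z hz
  have hz' : ‖z‖ < 1 := by simpa using hz
  have hz1 := ne_one_of_norm_lt_one hz'
  have hL : DifferentiableAt ℂ liMap z := (hasDerivAt_liMap hz1).differentiableAt
  have hL0 := liMap_ne_zero z hz1
  have hw : 0 < (liMap z).re := re_liMap_pos hz'
  have hψ : DifferentiableAt ℂ Complex.digamma (liMap z) :=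
    (Literature.Analysis.SpecialFunctions.Complex.differentiableOn_digamma _ hw).differentiableAt
      ((isOpen_lt continuous_const Complex.continuous_re).mem_nhds hw)
  have hψ' : DifferentiableAt ℂ (fun z ↦ Complex.digamma (liMap z)) z := hψ.comp z hL
  have hlog : DifferentiableAt ℂ (fun z ↦ Complex.log (liMap z)) z :=
    hL.clog (Complex.mem_slitPlane_iff.2 (Or.inl hw))
  have h2 : DifferentiableAt ℂ (fun z ↦ 1 / (2 * liMap z)) z :=
    (differentiableAt_const _).div ((differentiableAt_const _).mul hL) (mul_ne_zero two_ne_zero hL0)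
  have h3 : DifferentiableAt ℂ (fun z ↦ 1 / (12 * liMap z ^ 2)) z :=
    (differentiableAt_const _).div ((differentiableAt_const _).mul (hL.pow 2))
      (mul_ne_zero (by norm_num) (pow_ne_zero 2 hL0))
  exact ((hL.pow 2).mul (((hψ'.sub hlog).add h2).add h3)).differentiableWithinAt

/-- **Cauchy's estimate on the unit disc**: if `Φ` is holomorphic on `|z| < 1` with `‖Φ‖ ≤ M`
there, then `‖Φ⁽ᵐ⁾(0)‖ ≤ m! · M` (Cauchy's inequality on `|z| = r`, `r → 1⁻`). [folklore] -/
private theorem norm_iteratedDeriv_le_of_forall_mem_unitBall {Φ : ℂ → ℂ} {M : ℝ}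
    (hd : DifferentiableOn ℂ Φ (ball 0 1)) (hM : ∀ z ∈ ball (0 : ℂ) 1, ‖Φ z‖ ≤ M) (m : ℕ) :
    ‖iteratedDeriv m Φ 0‖ ≤ m ! * M := by
  have key : ∀ r : ℝ, 0 < r → r < 1 → ‖iteratedDeriv m Φ 0‖ ≤ m ! * M / r ^ m := by
    intro r hr0 hr1
    have hsub : closedBall (0 : ℂ) r ⊆ ball 0 1 := closedBall_subset_ball hr1
    have hdc : DiffContOnCl ℂ Φ (ball 0 r) :=
      (hd.mono (closure_ball_subset_closedBall.trans hsub)).diffContOnCl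
    exact Complex.norm_iteratedDeriv_le_of_forall_mem_sphere_norm_le m hr0 hdc
      fun z hz ↦ hM z (hsub (sphere_subset_closedBall hz))
  have hpow : Tendsto (fun r : ℝ ↦ r ^ m) (𝓝[<] (1 : ℝ)) (𝓝 1) := by
    have h := ((continuous_pow m).tendsto (1 : ℝ)).mono_left (nhdsWithin_le_nhds (s := Iio 1))
    simpa using h
  have hlim : Tendsto (fun r : ℝ ↦ (m ! : ℝ) * M / r ^ m) (𝓝[<] (1 : ℝ)) (𝓝 ((m ! : ℝ) * M)) := by
    have h := (tendsto_const_nhds (x := (m ! : ℝ) * M)).div hpow one_ne_zero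
    rw [div_one] at h
    exact h
  refine ge_of_tendsto hlim ?_
  filter_upwards [Ioo_mem_nhdsLT one_pos] with r hr
  exact key r hr.1 hr.2

/-- **Cauchy bound for the remainder coefficients**: `‖Φ⁽ᵐ⁾(0)‖ ≤ m!/(2π)`. [folklore] -/
private theorem norm_iteratedDeriv_oddRem_le (m : ℕ) :
    ‖iteratedDeriv m (fun z ↦ liMap z ^ 2 * (Complex.digamma (liMap z) - Complex.log (liMap z) +
      1 / (2 * liMap z) + 1 / (12 * liMap z ^ 2))) 0‖ ≤ m ! * (1 / (2 * Real.pi)) :=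
  norm_iteratedDeriv_le_of_forall_mem_unitBall differentiableOn_oddRem
    (fun z hz ↦ norm_oddRem_le (by simpa using hz)) m

/-- The remainder `Φ` is smooth at `0`. [folklore] -/
private theorem contDiffAt_oddRem (m : ℕ) :
    ContDiffAt ℂ m (fun z ↦ liMap z ^ 2 * (Complex.digamma (liMap z) - Complex.log (liMap z) +
      1 / (2 * liMap z) + 1 / (12 * liMap z ^ 2))) 0 :=
  (differentiableOn_oddRem.analyticAt (ball_mem_nhds (0 : ℂ) one_pos)).contDiffAt

/-- The elementary part `E` is smooth at `0`. [folklore] -/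
private theorem contDiffAt_oddElem (κ : ℂ) (m : ℕ) :
    ContDiffAt ℂ m (fun z ↦ κ * liMap z ^ 2 + liMap z / 2 - 1 / 12 +
        liMap z ^ 2 * Complex.log (liMap z)) 0 := by
  have hA : AnalyticAt ℂ liMap 0 := analyticAt_liMap zero_ne_one
  exact ((((analyticAt_const.mul (hA.pow 2)).add (hA.div analyticAt_const two_ne_zero)).sub
    analyticAt_const).add ((hA.pow 2).mul (analyticAt_log_liMap (by simp)))).contDiffAt

/-! ### The `ζ` generating function `𝒜_ζ = L + (−½ log π + ½ ψ(L/2)) L²` (black box from `KeiperLiTrend`) -/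

/-- `ψ` is analytic at every point of the right half-plane. [folklore] -/
private theorem analyticAt_digamma_of_re_pos' {w : ℂ} (hw : 0 < w.re) : AnalyticAt ℂ Complex.digamma w :=
  Literature.Analysis.SpecialFunctions.Complex.differentiableOn_digamma.analyticAt
    ((isOpen_lt continuous_const Complex.continuous_re).mem_nhds hw)

/-- The `ζ` trend generating function `𝒜_ζ` is smooth at `0`. [folklore] -/
private theorem contDiffAt_zetaTrendGen (m : ℕ) :
    ContDiffAt ℂ m (fun z ↦ liMap z + (-(Complex.log Real.pi) / 2 +
      Complex.digamma (liMap z / 2) / 2) * liMap z ^ 2) 0 := by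
  have hA : AnalyticAt ℂ liMap 0 := analyticAt_liMap zero_ne_one
  have hh : AnalyticAt ℂ (fun z ↦ liMap z / 2) 0 := hA.div analyticAt_const two_ne_zero
  have hψ : AnalyticAt ℂ Complex.digamma (1 / 2 : ℂ) := analyticAt_digamma_of_re_pos' (by simp)
  have hψc : AnalyticAt ℂ (fun z ↦ Complex.digamma (liMap z / 2)) 0 :=
    hψ.comp_of_eq hh (by simp)
  exact (hA.add ((analyticAt_const.add (hψc.div analyticAt_const two_ne_zero)).mul (hA.pow 2))).contDiffAt

/-- The harmonic number as a complex sum: `H_n = Σ_{i<n} 1/(i+1)`. [folklore] -/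
private theorem harmonic_cast_eq_sum (n : ℕ) :
    (((harmonic n : ℚ) : ℝ) : ℂ) = ∑ i ∈ Finset.range n, ((i : ℂ) + 1)⁻¹ := by
  simp [harmonic]

/-- **The `ζ` trend law as a statement about Taylor coefficients** (repackaging of
`KeiperLiTrend.abs_keiperLiCoeff_sub_osc_sub_trend_le` through `keiperLiCoeff_sub_osc_eq_iteratedDeriv`):
`|Re 𝒜_ζ^{(m)}(0)/m! − ( ((m+1)/2)(H_{m+1} − 1 − log 2π) + 1/2 )| ≤ 2/π`. [cite: Voros2006, §4 eq. (4.6)] -/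
theorem abs_re_zetaTrendGen_coeff_sub_le (m : ℕ) :
    |(iteratedDeriv m (fun z ↦ liMap z + (-(Complex.log Real.pi) / 2 +
        Complex.digamma (liMap z / 2) / 2) * liMap z ^ 2) 0 / (m ! : ℂ)).re -
      (((m + 1 : ℕ) : ℝ) / 2 * ((harmonic (m + 1) : ℝ) - 1 - Real.log (2 * Real.pi)) + 1 / 2)| ≤
      2 / Real.pi := by
  have h1 := abs_keiperLiCoeff_sub_osc_sub_trend_le (n := m + 1) (by omega)
  rw [keiperLiCoeff_sub_osc_eq_iteratedDeriv (n := m + 1) (by omega)] at h1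
  simpa only [Nat.add_sub_cancel] using h1

/-! ### EVEN characters: `𝒜_{c,0} = (c/2 + ½ ψ(L/2)) L²` -/

/-- Pointwise: `(c/2 + ½ψ(L/2)) L² = 𝒜_ζ(z) + (−L + ((c + log π)/2) L²)`. [folklore] -/
private theorem liTrendGen_even_eq (c : ℝ) (z : ℂ) :
    ((c : ℂ) / 2 + Complex.digamma (liMap z / 2) / 2) * liMap z ^ 2 =
      (liMap z + (-(Complex.log Real.pi) / 2 + Complex.digamma (liMap z / 2) / 2) * liMap z ^ 2) +
      (-liMap z + (((c + Real.log Real.pi) / 2 : ℝ) : ℂ) * liMap z ^ 2) := by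
  rw [← Complex.ofReal_log Real.pi_pos.le]
  push_cast
  ring

/-- **RH-FREE. The archimedean trend of the Li coefficients of an EVEN Dirichlet character.**  For every real
`c` and `m ≥ 0`, the Taylor coefficient of the Gamma-factor generating function
`𝒜_{c,0}(z) = (c/2 + ½ ψ(L/2))·L²`, `L = 1/(1−z)`, satisfies

  `| Re 𝒜_{c,0}^{(m)}(0)/m! − ( ((m+1)/2)(H_{m+1} − 1 − log 2 + c) − 1/2 ) | ≤ 2/π`.

With `c = log(q/π)` and `n = m + 1` this is the trend `lb_χ(n) = (n/2)(H_n − 1 − log(2π/q)) − 1/2 + O(1)` of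
`λ_χ(n)` for even `χ mod q` (Li 2004 (2.3); shape Lagarias 2007 (1.13)).  Proof: `𝒜_{c,0} = 𝒜_ζ − L +
((c + log π)/2) L²` and the `ζ` law `abs_re_zetaTrendGen_coeff_sub_le`.
[cite: Lagarias2007LiCoefficients, (1.13)–(1.15)] -/
theorem abs_re_liTrendGen_even_sub_le (c : ℝ) (m : ℕ) :
    |(iteratedDeriv m (fun z ↦ ((c : ℂ) / 2 + Complex.digamma (liMap z / 2) / 2) * liMap z ^ 2) 0 /
        (m ! : ℂ)).re -
      (((m + 1 : ℕ) : ℝ) / 2 * ((harmonic (m + 1) : ℝ) - 1 - Real.log 2 + c) - 1 / 2)| ≤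
      2 / Real.pi := by
  have hζ := abs_re_zetaTrendGen_coeff_sub_le m
  have hA : AnalyticAt ℂ liMap 0 := analyticAt_liMap zero_ne_one
  have hP : ContDiffAt ℂ m (fun z ↦ -liMap z + (((c + Real.log Real.pi) / 2 : ℝ) : ℂ) * liMap z ^ 2) 0 :=
    (hA.neg.add (analyticAt_const.mul (hA.pow 2))).contDiffAt
  have hfun : (fun z ↦ ((c : ℂ) / 2 + Complex.digamma (liMap z / 2) / 2) * liMap z ^ 2) =
      fun z ↦ (liMap z + (-(Complex.log Real.pi) / 2 + Complex.digamma (liMap z / 2) / 2) * liMap z ^ 2) +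
        (-liMap z + (((c + Real.log Real.pi) / 2 : ℝ) : ℂ) * liMap z ^ 2) :=
    funext (liTrendGen_even_eq c)
  have hN : ContDiffAt ℂ m (fun z ↦ -liMap z) 0 := hA.neg.contDiffAt
  have hK : ContDiffAt ℂ m (fun z ↦ (((c + Real.log Real.pi) / 2 : ℝ) : ℂ) * liMap z ^ 2) 0 :=
    (analyticAt_const.mul (hA.pow 2)).contDiffAt
  have hpoly : iteratedDeriv m (fun z ↦ -liMap z + (((c + Real.log Real.pi) / 2 : ℝ) : ℂ) * liMap z ^ 2) 0 =
      -(m ! : ℂ) + (((c + Real.log Real.pi) / 2 : ℝ) : ℂ) * ((m + 1)! : ℂ) := by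
    rw [iteratedDeriv_fun_add hN hK, iteratedDeriv_fun_neg, iteratedDeriv_liMap_zero,
      iteratedDeriv_const_mul_field, iteratedDeriv_liMap_sq_zero]
  set Z := iteratedDeriv m (fun z ↦ liMap z + (-(Complex.log Real.pi) / 2 +
        Complex.digamma (liMap z / 2) / 2) * liMap z ^ 2) 0 with hZ
  rw [hfun, iteratedDeriv_fun_add (contDiffAt_zetaTrendGen m) hP, hpoly]
  have hfact : (m ! : ℂ) ≠ 0 := by exact_mod_cast Nat.factorial_ne_zero m
  have hfpos : (0 : ℝ) < m ! := by exact_mod_cast Nat.factorial_pos m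
  -- the polynomial part divided by `m!` is the real number `−1 + ((c + log π)/2)(m+1)`
  have hq : (-(m ! : ℂ) + (((c + Real.log Real.pi) / 2 : ℝ) : ℂ) * ((m + 1)! : ℂ)) / (m ! : ℂ) =
      ((-1 + (c + Real.log Real.pi) / 2 * ((m : ℝ) + 1) : ℝ) : ℂ) := by
    rw [div_eq_iff hfact]
    push_cast [Nat.factorial_succ]
    ring
  rw [add_div, hq, Complex.add_re, Complex.ofReal_re]
  have hlog : Real.log (2 * Real.pi) = Real.log 2 + Real.log Real.pi :=
    Real.log_mul two_ne_zero Real.pi_ne_zero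
  rw [hlog] at hζ
  have hid : (Z / (m ! : ℂ)).re + (-1 + (c + Real.log Real.pi) / 2 * ((m : ℝ) + 1)) -
      (((m + 1 : ℕ) : ℝ) / 2 * ((harmonic (m + 1) : ℝ) - 1 - Real.log 2 + c) - 1 / 2) =
      (Z / (m ! : ℂ)).re -
      (((m + 1 : ℕ) : ℝ) / 2 * ((harmonic (m + 1) : ℝ) - 1 - (Real.log 2 + Real.log Real.pi)) + 1 / 2) := by
    push_cast; ring
  rw [hid]
  exact hζ

/-! ### ODD characters: `𝒜_{c,1} = (c/2 + ½ ψ((L+1)/2)) L²` -/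

/-- On the unit disc (duplication + Stirling): `(c/2 + ½ψ((L+1)/2)) L² = E(z) + Φ(z) − 𝒜_ζ(z)` with
`E = κL² + L/2 − 1/12 + L² Log L`, `κ = c/2 − log 2 − ½ log π`, `Φ = L²(ψ(L) − Log L + 1/(2L) + 1/(12L²))`.
[folklore] -/
private theorem liTrendGen_odd_eventuallyEq (c : ℝ) :
    (fun z ↦ ((c : ℂ) / 2 + Complex.digamma ((liMap z + 1) / 2) / 2) * liMap z ^ 2) =ᶠ[𝓝 (0 : ℂ)]
      fun z ↦ ((((c / 2 - Real.log 2 - Real.log Real.pi / 2 : ℝ) : ℂ) * liMap z ^ 2 + liMap z / 2 - 1 / 12 +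
          liMap z ^ 2 * Complex.log (liMap z)) +
        liMap z ^ 2 * (Complex.digamma (liMap z) - Complex.log (liMap z) + 1 / (2 * liMap z) +
          1 / (12 * liMap z ^ 2))) -
        (liMap z + (-(Complex.log Real.pi) / 2 + Complex.digamma (liMap z / 2) / 2) * liMap z ^ 2) := by
  filter_upwards [Metric.ball_mem_nhds (0 : ℂ) one_pos] with z hz
  have hz' : ‖z‖ < 1 := by simpa using hz
  have hL0 : liMap z ≠ 0 := liMap_ne_zero z (ne_one_of_norm_lt_one hz')
  have hw : 0 < (liMap z / 2).re := re_liMap_half_pos hz'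
  -- Legendre duplication at `s = L/2`: `ψ(L/2) + ψ(L/2 + 1/2) = 2ψ(L) − 2 log 2`
  have hdup := Literature.Analysis.SpecialFunctions.Complex.digamma_add_digamma_add_half
    (s := liMap z / 2) (fun k hk ↦ by
      have hk' : liMap z = -(k : ℂ) := by rw [← hk]; ring
      have h2 : (liMap z).re = -(k : ℝ) := by rw [hk']; simp
      linarith [re_liMap_pos hz', (Nat.cast_nonneg k : (0 : ℝ) ≤ k)])
  have hhalf : liMap z / 2 + 1 / 2 = (liMap z + 1) / 2 := by ring
  have htwo : 2 * (liMap z / 2) = liMap z := by ring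
  rw [hhalf, htwo] at hdup
  have hψ : Complex.digamma ((liMap z + 1) / 2) =
      2 * Complex.digamma (liMap z) - 2 * Complex.log 2 - Complex.digamma (liMap z / 2) := by
    linear_combination hdup
  rw [hψ, ← Complex.ofReal_log Real.pi_pos.le,
    show (Complex.log 2 : ℂ) = ((Real.log 2 : ℝ) : ℂ) by
      rw [show (2 : ℂ) = ((2 : ℝ) : ℂ) by norm_num, Complex.ofReal_log (by norm_num : (0:ℝ) ≤ 2)]]
  push_cast
  field_simp
  ring

/-- **RH-FREE. The archimedean trend of the Li coefficients of an ODD Dirichlet character.**  For every real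
`c` and `m ≥ 0`, the Taylor coefficient of the Gamma-factor generating function
`𝒜_{c,1}(z) = (c/2 + ½ ψ((L+1)/2))·L²`, `L = 1/(1−z)`, satisfies

  `| Re 𝒜_{c,1}^{(m)}(0)/m! − ((m+1)/2)(H_{m+1} − 1 − log 2 + c) | ≤ 1/12 + 1/(2π) + 2/π`.

With `c = log(q/π)` and `n = m + 1` this is the trend `lb_χ(n) = (n/2)(H_n − 1 − log(2π/q)) + O(1)` of `λ_χ(n)`
for odd `χ mod q` — the constant `(a−1)/2 = 0` (Li 2004 (2.3); shape Lagarias 2007 (1.13)).  Proof: duplication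
`ψ((L+1)/2) = 2ψ(L) − 2 log 2 − ψ(L/2)`, Stirling for `ψ(L)` with Cauchy's estimate on the unit disc, and the `ζ` law
for the `ψ(L/2)` part.
[cite: Lagarias2007LiCoefficients, (1.13)–(1.15)] -/
theorem abs_re_liTrendGen_odd_sub_le (c : ℝ) (m : ℕ) :
    |(iteratedDeriv m (fun z ↦ ((c : ℂ) / 2 + Complex.digamma ((liMap z + 1) / 2) / 2) * liMap z ^ 2) 0 /
        (m ! : ℂ)).re -
      (((m + 1 : ℕ) : ℝ) / 2 * ((harmonic (m + 1) : ℝ) - 1 - Real.log 2 + c))| ≤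
      1 / 12 + 1 / (2 * Real.pi) + 2 / Real.pi := by
  have hζ := abs_re_zetaTrendGen_coeff_sub_le m
  set κ : ℝ := c / 2 - Real.log 2 - Real.log Real.pi / 2 with hκ
  rw [(liTrendGen_odd_eventuallyEq c).iteratedDeriv_eq,
    iteratedDeriv_fun_sub ((contDiffAt_oddElem (κ : ℂ) m).add (contDiffAt_oddRem m))
      (contDiffAt_zetaTrendGen m),
    iteratedDeriv_fun_add (contDiffAt_oddElem (κ : ℂ) m) (contDiffAt_oddRem m),
    iteratedDeriv_oddElem_zero (κ : ℂ) m, ← harmonic_cast_eq_sum]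
  set Φm := iteratedDeriv m (fun z ↦ liMap z ^ 2 * (Complex.digamma (liMap z) - Complex.log (liMap z) +
      1 / (2 * liMap z) + 1 / (12 * liMap z ^ 2))) 0 with hΦm
  set Z := iteratedDeriv m (fun z ↦ liMap z + (-(Complex.log Real.pi) / 2 +
        Complex.digamma (liMap z / 2) / 2) * liMap z ^ 2) 0 with hZ
  have hfact : (m ! : ℂ) ≠ 0 := by exact_mod_cast Nat.factorial_ne_zero m
  have hfpos : (0 : ℝ) < m ! := by exact_mod_cast Nat.factorial_pos m
  -- the elementary part is real
  set e : ℝ := if m = 0 then 1 / 12 else 0 with he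
  have hX : (m ! : ℂ) * ((κ : ℂ) * ((m : ℂ) + 1) + 1 / 2 - (if m = 0 then 1 / 12 else 0) +
      ((m : ℂ) + 1) * ((((harmonic (m + 1) : ℚ) : ℝ) : ℂ) - 1)) =
      (((m ! : ℝ) * (κ * ((m : ℝ) + 1) + 1 / 2 - e +
        ((m : ℝ) + 1) * (((harmonic (m + 1) : ℚ) : ℝ) - 1)) : ℝ) : ℂ) := by
    rw [he]; split_ifs <;> push_cast <;> ring
  rw [hX, sub_div, add_div, Complex.sub_re, Complex.add_re, ← Complex.ofReal_natCast, ← Complex.ofReal_div,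
    Complex.ofReal_re, mul_div_cancel_left₀ _ hfpos.ne']
  have hlog : Real.log (2 * Real.pi) = Real.log 2 + Real.log Real.pi :=
    Real.log_mul two_ne_zero Real.pi_ne_zero
  rw [hlog] at hζ
  -- algebra: the difference is `−e + Re(Φm/m!) − (Re(Z/m!) − ζ-main)`
  have hid : κ * ((m : ℝ) + 1) + 1 / 2 - e + ((m : ℝ) + 1) * (((harmonic (m + 1) : ℚ) : ℝ) - 1) +
      (Φm / ((m ! : ℝ) : ℂ)).re - (Z / ((m ! : ℝ) : ℂ)).re -
      (((m + 1 : ℕ) : ℝ) / 2 * (((harmonic (m + 1) : ℚ) : ℝ) - 1 - Real.log 2 + c)) =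
      -e + (Φm / ((m ! : ℝ) : ℂ)).re - ((Z / ((m ! : ℝ) : ℂ)).re -
        (((m + 1 : ℕ) : ℝ) / 2 * (((harmonic (m + 1) : ℚ) : ℝ) - 1 - (Real.log 2 + Real.log Real.pi)) + 1 / 2)) := by
    rw [hκ]; push_cast; ring
  rw [hid]
  have hΦre : |(Φm / ((m ! : ℝ) : ℂ)).re| ≤ 1 / (2 * Real.pi) := by
    refine (Complex.abs_re_le_norm _).trans ?_
    rw [norm_div, Complex.norm_of_nonneg hfpos.le, div_le_iff₀ hfpos]
    have h1 : ‖Φm‖ ≤ m ! * (1 / (2 * Real.pi)) := by rw [hΦm]; exact norm_iteratedDeriv_oddRem_le m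
    linarith
  have he0 : |e| ≤ 1 / 12 := by
    rw [he]; split_ifs <;> norm_num
  have hζ' : |(Z / ((m ! : ℝ) : ℂ)).re -
      (((m + 1 : ℕ) : ℝ) / 2 * (((harmonic (m + 1) : ℚ) : ℝ) - 1 - (Real.log 2 + Real.log Real.pi)) + 1 / 2)| ≤
      2 / Real.pi := by
    rw [Complex.ofReal_natCast]; exact hζ
  calc |-e + (Φm / ((m ! : ℝ) : ℂ)).re - ((Z / ((m ! : ℝ) : ℂ)).re -
        (((m + 1 : ℕ) : ℝ) / 2 * (((harmonic (m + 1) : ℚ) : ℝ) - 1 - (Real.log 2 + Real.log Real.pi)) + 1 / 2))|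
      ≤ |-e + (Φm / ((m ! : ℝ) : ℂ)).re| + |(Z / ((m ! : ℝ) : ℂ)).re -
        (((m + 1 : ℕ) : ℝ) / 2 * (((harmonic (m + 1) : ℚ) : ℝ) - 1 - (Real.log 2 + Real.log Real.pi)) + 1 / 2)| :=
        abs_sub _ _
    _ ≤ (|-e| + |(Φm / ((m ! : ℝ) : ℂ)).re|) + 2 / Real.pi := add_le_add (abs_add_le _ _) hζ'
    _ ≤ (1 / 12 + 1 / (2 * Real.pi)) + 2 / Real.pi := by
        gcongr
        · rw [abs_neg]; exact he0
    _ = 1 / 12 + 1 / (2 * Real.pi) + 2 / Real.pi := by ring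

/-- **RH-FREE. Uniform form for both parities.**  For `a ∈ {0, 1}`, every real `c` and `m ≥ 0`:

  `| Re 𝒜_{c,a}^{(m)}(0)/m! − ( ((m+1)/2)(H_{m+1} − 1 − log 2 + c) + (a − 1)/2 ) | ≤ 1`,

`𝒜_{c,a}(z) = (c/2 + ½ ψ((L+a)/2))·L²`, `L = 1/(1−z)` — the archimedean trend of the Li coefficients of a
Dirichlet character of parity `a` and conductor `q = π e^c` is `(n/2)(H_n − 1 − log(2π/q)) + (a−1)/2 + O(1)` with the
explicit constant `1` (`2/π ≤ 1` and `1/12 + 5/(2π) ≤ 1`). [cite: Lagarias2007LiCoefficients, (1.13)–(1.15)] -/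
theorem abs_re_liTrendGen_sub_le (c : ℝ) {a : ℕ} (ha : a ≤ 1) (m : ℕ) :
    |(iteratedDeriv m (fun z ↦ ((c : ℂ) / 2 + Complex.digamma ((liMap z + (a : ℂ)) / 2) / 2) *
        liMap z ^ 2) 0 / (m ! : ℂ)).re -
      (((m + 1 : ℕ) : ℝ) / 2 * ((harmonic (m + 1) : ℝ) - 1 - Real.log 2 + c) + ((a : ℝ) - 1) / 2)| ≤ 1 := by
  have hπ3 : (3 : ℝ) < Real.pi := Real.pi_gt_three
  have hπ0 : 0 < Real.pi := Real.pi_pos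
  interval_cases a
  · -- even
    have h := abs_re_liTrendGen_even_sub_le c m
    simp only [Nat.cast_zero, add_zero, zero_sub] at h ⊢
    have h2 : 2 / Real.pi ≤ 1 := by rw [div_le_one hπ0]; linarith
    have hrw : ((m + 1 : ℕ) : ℝ) / 2 * (((harmonic (m + 1) : ℚ) : ℝ) - 1 - Real.log 2 + c) + -1 / 2 =
        ((m + 1 : ℕ) : ℝ) / 2 * (((harmonic (m + 1) : ℚ) : ℝ) - 1 - Real.log 2 + c) - 1 / 2 := by ring
    rw [hrw]
    exact h.trans h2
  · -- odd
    have h := abs_re_liTrendGen_odd_sub_le c m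
    simp only [Nat.cast_one, sub_self, zero_div, add_zero] at h ⊢
    have h2 : 1 / 12 + 1 / (2 * Real.pi) + 2 / Real.pi ≤ 1 := by
      have : 1 / (2 * Real.pi) + 2 / Real.pi = 5 / (2 * Real.pi) := by field_simp; ring
      rw [add_assoc, this]
      have h5 : 5 / (2 * Real.pi) ≤ 5 / 6 := by
        rw [div_le_div_iff₀ (by positivity) (by norm_num)]; linarith
      linarith
    exact h.trans h2

end Literature.NumberTheory.LFunctions

end
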